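import Summits.Ventures.PercRepro.RankLevelSetRuleQSliceMapRecordTwo
import Summits.Ventures.PercRepro.RankLevelSetRuleQSliceThirdUntrunc
import Summits.Ventures.PercRepro.RankLevelSetRuleQSliceBandSharp

/-!
# PercRepro — THE MAP OF RULE Q ON EVERY FAMILY `k ≥ 5`: THE STATEMENT OF RECORD, THIRD EDITION (night-1, gen 22; dossier §33.6)

`ruleQ_slice_map_of_record_two` with the third untruncated slice `u = k + 1` (every cell) and the sharp band: for every family
`k ≥ 5`, at the tight layer, the slices `u ≤ 1` are paid on every cell; the slices `2 ≤ u ≤ k − 3` are not; the slices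
`u = k − 2, k − 1, k, k + 1` are paid on every cell; every slice `u ≥ k − 1` with `4u² ≤ q − u` and `(u+k)² ≤ q − u + 2` is paid.
Arithmetic level `ruleQ_slice_map_of_record_three`, matroid level `ruleQ_slice_map_of_record_three_matroid`. Axioms: standard.
-/

namespace PercRepro

open Set Matroid Finset

/-- **THE MAP OF RULE Q ON THE FAMILY `k ≥ 5`, THIRD EDITION** (arithmetic level). -/
theorem ruleQ_slice_map_of_record_three (k : ℕ) (hk : 5 ≤ k) :
    (∀ u, u ≤ 1 → ∀ q, u ≤ q → phiK (q + k) q ≤ rhat q k (q - u))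
    ∧ (∀ u, 2 ≤ u → u + 3 ≤ k → ¬ ∀ q, u ≤ q → phiK (q + k) q ≤ rhat q k (q - u))
    ∧ (∀ q, k - 2 ≤ q → phiK (q + k) q ≤ rhat q k (q - (k - 2)))
    ∧ (∀ q, k - 1 ≤ q → phiK (q + k) q ≤ rhat q k (q - (k - 1)))
    ∧ (∀ q, k ≤ q → phiK (q + k) q ≤ rhat q k (q - k))
    ∧ (∀ q, k + 1 ≤ q → phiK (q + k) q ≤ rhat q k (q - (k + 1)))
    ∧ (∀ u q, k - 1 ≤ u → u ≤ q → 4 * u ^ 2 ≤ q - u → (u + k) ^ 2 ≤ q - u + 2 →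
        phiK (q + k) q ≤ rhat q k (q - u)) := by
  obtain ⟨h1, h2, h3, h4, h5, -⟩ := ruleQ_slice_map_of_record_two k hk
  exact ⟨h1, h2, h3, h4, h5, fun q hq => third_untrunc_slice_every k q hk hq,
    fun u q hu huq hm1 hm2 => slice_band_sharp k u q hk hu huq hm1 hm2⟩

/-- **THE MAP AT THE MATROID LEVEL, THIRD EDITION**. -/
theorem ruleQ_slice_map_of_record_three_matroid (k : ℕ) (hk : 5 ≤ k) :
    (∀ (β : Type) (M : Matroid β) (hf : M.Finite) (q : ℕ), M.E.ncard = (q + k) + q →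
        ∀ Z ∈ cellMembers M (q + k) q, q ≤ (flatPart M Z).ncard + 1 → phiK (q + k) q ≤ @ruleQRecv β M hf (q + k) q Z)
    ∧ (∀ u, 2 ≤ u → u + 3 ≤ k → ∀ q, 4 ^ (k + 3) + u ≤ q →
        ∃ (β : Type) (M : Matroid β) (hf : M.Finite) (Z : Set β), M.E.ncard = (q + k) + q ∧ Z ∈ cellMembers M (q + k) q ∧
          (flatPart M Z).ncard = q - u ∧ @ruleQRecv β M hf (q + k) q Z < phiK (q + k) q)
    ∧ (∀ (β : Type) (M : Matroid β) (hf : M.Finite) (q : ℕ), k - 2 ≤ q → M.E.ncard = (q + k) + q →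
        ∀ Z ∈ cellMembers M (q + k) q, (flatPart M Z).ncard = q - (k - 2) → phiK (q + k) q ≤ @ruleQRecv β M hf (q + k) q Z)
    ∧ (∀ (β : Type) (M : Matroid β) (hf : M.Finite) (q : ℕ), k - 1 ≤ q → M.E.ncard = (q + k) + q →
        ∀ Z ∈ cellMembers M (q + k) q, (flatPart M Z).ncard = q - (k - 1) → phiK (q + k) q ≤ @ruleQRecv β M hf (q + k) q Z)
    ∧ (∀ (β : Type) (M : Matroid β) (hf : M.Finite) (q : ℕ), k ≤ q → M.E.ncard = (q + k) + q →
        ∀ Z ∈ cellMembers M (q + k) q, (flatPart M Z).ncard = q - k → phiK (q + k) q ≤ @ruleQRecv β M hf (q + k) q Z)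
    ∧ (∀ (β : Type) (M : Matroid β) (hf : M.Finite) (q : ℕ), k + 1 ≤ q → M.E.ncard = (q + k) + q →
        ∀ Z ∈ cellMembers M (q + k) q, (flatPart M Z).ncard = q - (k + 1) → phiK (q + k) q ≤ @ruleQRecv β M hf (q + k) q Z)
    ∧ (∀ (β : Type) (M : Matroid β) (hf : M.Finite) (q u : ℕ), k - 1 ≤ u → u ≤ q → 4 * u ^ 2 ≤ q - u →
        (u + k) ^ 2 ≤ q - u + 2 → M.E.ncard = (q + k) + q →
        ∀ Z ∈ cellMembers M (q + k) q, (flatPart M Z).ncard = q - u → phiK (q + k) q ≤ @ruleQRecv β M hf (q + k) q Z) := by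
  obtain ⟨h1, h2, h3, h4, h5, -⟩ := ruleQ_slice_map_of_record_two_matroid k hk
  exact ⟨h1, h2, h3, h4, h5,
    fun β M hf q hq hE Z hZ hP => @ruleQRecv_ge_phiK_third_untrunc_every β M hf q k hk hq hE Z hZ hP,
    fun β M hf q u hu huq hm1 hm2 hE Z hZ hP => @ruleQRecv_ge_phiK_band_sharp β M hf q k u hk hu huq hm1 hm2 hE Z hZ hP⟩

end PercRepro
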